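import Summits.BirchSwinnertonDyer.Rank1Residual.O6.O6Targets
import Summits.BirchSwinnertonDyer.Rank1Residual.O5.O5Targets
import Summits.BirchSwinnertonDyer.Rank1Residual.O5.HeegnerIndexThree
import Summits.BirchSwinnertonDyer.Rank1Residual.Additive.WildThreeRefinedKolyvagin
import HarnessLib

/-!
# O5 / O6 joint closure shape in the kernel — the two CONVERGED targets compose to the class output
# (cell `b2b-bsdres`, lane CLASS-CLOSURE, seat cc-typer-5; bookkeeping theorems only, NOTHING ASSERTED)

HONEST FRAMING (cell `b2b-bsdres`, run/shared/lean/b2b/bsd-rank1-residual/, verbatim in every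
file): the goal of the cell is to DELETE the COMBINATION-SHAPED residual classes of the
Birch–Swinnerton-Dyer formula for ALL analytic-rank `≤ 1` elliptic curves over `ℚ` — "full BSD
formula for every rank `≤ 1` curve in class `C`" assembled STRICTLY from published theorems — so
that the rank-`≤ 1` remainder becomes exactly the CONSTRUCTION-SHAPED classes, which are TYPED
(missing-input `Prop`s), NOT attempted. This is not "finishing BSD". Lane CLASS-CLOSURE
(`CLASS-CLOSURE-PLAN.md` §3.4 O6 / §3.5 O5; convergence file `cells/o5o6/TARGETS.md`, "JOINT CLOSURE
SHAPE" lines of §O5 and §O6): research routes; no claim beyond the stated classes; nothing is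
booked; no mark of `RESIDUAL-MAP.md` moves; no Literature fact, no definition, no conjecture is
introduced here — every conjectural input (Kato's main conjecture `KMC`, the shared lower-half shell,
Gross's Conjecture 1.2 `HeegnerIndexBSDAt`) and every published input (Kato Thm. 14.5 (3),
Gross–Zagier–Kolyvagin, modularity) is an EXPLICIT hypothesis, and the per-pair census data (STEP-0
identity of the analytic orders, `3 ∤ ∏ c_ℓ`, the Manin datum) are explicit binders.

## What is recorded

1. `lowerHalfRankZeroOfKMC_of_shared`: the O6 target T-O6-A (A0) `O6.LowerHalfRankZeroOfKMC KMC`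
   (`O6/O6Targets.lean`) IS the `ClassX4 ∧ SubW` restriction of the shared O5 ∪ O6 descent shell
   `O5.PotSupersingularLowerHalfRankZeroOfKMC KMC` (`O5/O5Targets.lean`), modulo modularity (to read
   `r_an = 0` as `L(E,1) ≠ 0`) and Gross–Zagier–Kolyvagin (finiteness of `Ш`) — so the shell is typed
   ONCE, as the two planner teams agreed (TARGETS.md §O5 o5-r1 ⟦05:25Z⟧).
2. `towerSurjThree_of_forall` / `towerSurjThree_of_imageContainsSL2`: the census bit `towerSurj3` =
   Kato's (12.5.2) `Kato2004.ImageContainsSL2 W 3` feeds o6-r2's binder `AdditiveThree.TowerSurjThree`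
   (`Additive/WildThreeRefinedKolyvagin.lean`).
3. **`missingPPartAt_three_rankOne_of_heegnerIndexBSDAt_of_shared`** — the JOINT CLOSURE SHAPE of
   TARGETS.md in kernel form, for a RANK-ONE O5/O6 curve `W` (X4, `3`-adic tower surjective): Gross's
   Conjecture 1.2 at the pair (`O5.HeegnerIndexBSDAt W 3`, i.e. T-O5-B / T-O6-C at `W`) + the shared
   r0 LOWER-half shell applied to the Heegner TWIST `Wd = E^{(d_K)}` (again an O5/O6 pair, rank `0`) +
   Kato's UPPER half for `Wd` (kernel, gen 0 `ClassO5/ClassO6.missingPPartAt_iff_lower_of_kato`) +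
   the STEP-0 identity of the analytic orders ⇒ `MissingPPartAt W 3` (the `3`-part for the rank-one
   member), via o5-r2's transport law `O5.missingPPartAt_twist_of_pairIdentity`. Rank `0`: see
   `O6.missingPPartAt_three_of_lowerHalfOfKMC_of_kato` (O6Targets) and gen 0's
   `bsdp_rankZero_of_potGoodLowerHalf_of_kato`.

References: `cells/o5o6/TARGETS.md` §O5/§O6 (sha16 `12688f0362ad85a1`); Kato, Astérisque 295 (2004)
Conj. 12.10, Thm. 14.5 (3) [Kato2004Asterisque]; B. H. Gross, LMS LN 153 (1991) Conj. 1.2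
[GrossLMS1991]; R. L. Miller, LMS JCM 14 (2011) Def. 1.1 [Miller2011LMS].
-/

noncomputable section

open scoped Classical

open WeierstrassCurve Literature.NumberTheory.EllipticCurves
  Literature.NumberTheory.EllipticCurves.ModularForms
  Literature.NumberTheory.EllipticCurves.Rank1Residual
  Literature.NumberTheory.EllipticCurves.Rank1Residual.Typed
  Summit.BirchSwinnertonDyer.Rank1Residual.Additive

namespace Summit.BirchSwinnertonDyer.Rank1Residual.O6

/-! ## §1 The shared shell restricts to T-O6-A (A0) -/

section Shared

variable (KMC : ∀ (W : WeierstrassCurve ℚ) [W.IsElliptic] [W.IsGloballyMinimal] (p : ℕ), Prop)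

/-- **T-O6-A (A0) ⇐ the shared O5 ∪ O6 descent shell** (typed once in `O5/O5Targets.lean`): a wild
X4 pair is an O6 pair (`ClassO6 W 3 = 3 ≠ 2 ∧ Addv W 3 ∧ SubW W 3`); analytic rank `0` reads
`L(E,1) ≠ 0` by modularity (`hmod`, `analyticRank_eq_zero_iff_holds`) and gives `Ш` finite by
Gross–Zagier–Kolyvagin (`hGZK`). Bookkeeping; nothing credited. [folklore] -/
theorem lowerHalfRankZeroOfKMC_of_shared (hmod : hasEntireLFunction_rat)
    (hGZK : rank_eq_analyticRank_of_analyticRank_le_one)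
    (h : O5.PotSupersingularLowerHalfRankZeroOfKMC KMC) : LowerHalfRankZeroOfKMC KMC := by
  intro W _ _ hr hX hW himg hK
  have hO : ClassO6 W 3 := ⟨hX.1, hX.2.1, hW⟩
  have hL : W.entireLFunction 1 ≠ 0 := (W.analyticRank_eq_zero_iff_holds (hmod W)).mp hr
  have hfin : Finite W.sha := (hGZK W (hr.le.trans zero_le_one)).2
  exact h W (Or.inr hO) himg hK hL hfin

end Shared

/-! ## §2 The census bit (12.5.2) feeds o6-r2's tower binder -/

/-- `∀ n, ρ̄_{E,3ⁿ}` onto ⟹ `AdditiveThree.TowerSurjThree W` (the latter quantifies `n ≥ 1` only).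
[folklore] -/
theorem towerSurjThree_of_forall (W : WeierstrassCurve ℚ)
    (h : ∀ n : ℕ, W.HasSurjectiveModNGaloisRep (3 ^ n : ℕ)) : AdditiveThree.TowerSurjThree W :=
  fun n _ ↦ by exact_mod_cast h n

/-- Kato's (12.5.2) at `3` (`Kato2004.ImageContainsSL2 W 3`, = the census bit `towerSurj3` by
`imageContainsSL2_iff_forall_hasSurjectiveModNGaloisRep`) ⟹ `AdditiveThree.TowerSurjThree W`.
[cite: Kato2004Asterisque, (12.5.2) in Thm. 12.5 (4) (p. 222)] -/
theorem towerSurjThree_of_imageContainsSL2 (W : WeierstrassCurve ℚ) [W.IsElliptic]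
    (h : Kato2004.ImageContainsSL2 W 3) : AdditiveThree.TowerSurjThree W :=
  towerSurjThree_of_forall W
    ((Kato2004.imageContainsSL2_iff_forall_hasSurjectiveModNGaloisRep W 3).mp h)

/-! ## §3 The joint closure shape for a RANK-ONE O5/O6 curve -/

section RankOne

variable (KMC : ∀ (W : WeierstrassCurve ℚ) [W.IsElliptic] [W.IsGloballyMinimal] (p : ℕ), Prop)

/-- **JOINT CLOSURE SHAPE, rank one (TARGETS.md §O5/§O6), kernel form.** Let `W` be globally
minimal of analytic rank `≤ 1` with `ρ̄_{E,3}` onto, `D` a parametrisation datum at level `N`, `K` a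
Heegner field for `N` with `d_K < −4`, `P ∈ E(K)` of infinite order mapping to the Heegner point of
`(D, H)`, and `Wd` a `ℚ`-model of the twist `E^{(d_K)}` of analytic rank `0` lying again in O5 ∪ O6
(`ClassO5 Wd 3 ∨ ClassO6 Wd 3` — a quadratic twist unramified at `3` keeps the local type; carried as
a hypothesis) with `ClassX4 Wd 3`, `3`-adic tower surjectivity, `3 ∤ ∏ c_ℓ(Wd)` and a datum `Dd` with
`3 ∤ c_{Dd}`. GRANTED, as explicit hypotheses: Gross's Conjecture 1.2 `3`-adically at the pair
(`hHI : O5.HeegnerIndexBSDAt W 3` — T-O5-B / T-O6-C), the shared r0 lower-half shell (`hshared`)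
together with Kato's main conjecture for `Wd` (`hKMC : KMC Wd 3`) — T-O5-A / T-O6-A —, the PUBLISHED
facts Kato Thm. 14.5 (3) (`hKato`), Gross–Zagier–Kolyvagin (`hGZK`), modularity (`hmod`), and the
per-pair STEP-0 identity of the analytic orders (`hstep0`, Gross–Zagier in the census currency):
then `MissingPPartAt W 3` — the `3`-part of BSD in Miller's currency for the RANK-ONE member.
Route: `Wd` gets its `3`-part from lower (shell) + upper (Kato) (`ClassO5/ClassO6.missingPPartAt_iff_lower_of_kato`);
the pair identity (`O5.padicValNat_shaOrder_add_twist_eq_of_heegnerIndexBSDAt`) and STEP-0 transport it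
to `W` (`O5.missingPPartAt_twist_of_pairIdentity`). Nothing is credited; no conjecture is used
silently. [cite: GrossLMS1991, §1 Conj. 1.2 (p. 237)] [cite: Kato2004Asterisque, Thm. 14.5 (3) (p. 236)]
[cite: Miller2011LMS, Def. 1.1 (arXiv:1010.2431 p. 3)] -/
theorem missingPPartAt_three_rankOne_of_heegnerIndexBSDAt_of_shared
    (hshared : O5.PotSupersingularLowerHalfRankZeroOfKMC KMC)
    (hKato : Kato2004.rankZero_padicValNat_sha_le_of_additive_potGood_of_imageContainsSL2)
    (hGZK : rank_eq_analyticRank_of_analyticRank_le_one) (hmod : hasEntireLFunction_rat)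
    -- the rank-one curve and its Heegner pair
    (W : WeierstrassCurve ℚ) [W.IsElliptic] [W.IsGloballyMinimal] (hr : W.analyticRank ≤ 1)
    (hHI : O5.HeegnerIndexBSDAt W 3) (hρ : W.HasSurjectiveModNGaloisRep 3)
    {N : ℕ} [NeZero N] (D : ModularParametrizationData W N)
    (K : Type) [Field K] [NumberField K] (hK : IsImaginaryQuadratic K)
    (hH : SatisfiesHeegnerHypothesis N K) (hdK : NumberField.discr K < -4)
    (H : HeegnerDatum N (NumberField.discr K)) (ι : K →+* ℂ) {P : (W.baseChange K).toAffine.Point}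
    (hP : WeierstrassCurve.Affine.Point.map ι.toRatAlgHom P = heegnerPointComplex D H)
    (hnt : ¬ IsOfFinAddOrder P)
    -- the rank-zero twist, again an O5/O6 pair
    (Wd : WeierstrassCurve ℚ) [Wd.IsElliptic] [Wd.IsGloballyMinimal]
    (hWd : ∃ C : VariableChange ℚ, C • W.quadraticTwist (NumberField.discr K : ℚ) = Wd)
    (hrD : Wd.analyticRank = 0) (hOd : ClassO5 Wd 3 ∨ ClassO6 Wd 3) (hXd : ClassX4 Wd 3)
    (htowerd : ∀ n : ℕ, Wd.HasSurjectiveModNGaloisRep (3 ^ n : ℕ))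
    (htamd : ¬ 3 ∣ Wd.tamagawaProduct)
    {Nd : ℕ} [NeZero Nd] (Dd : ModularParametrizationData Wd Nd) (hcd : ¬ (3 : ℤ) ∣ Dd.maninConstant)
    (hKMC : KMC Wd 3)
    -- STEP-0: Gross–Zagier in the census currency at this pair
    {q₀ q₁ : ℚ} (hq₀ : shaAn W = (q₀ : ℂ)) (hq₁ : shaAn Wd = (q₁ : ℂ))
    (hstep0 : padicValRat 3 q₀ + padicValRat 3 q₁ + ((2 * padicValNat 3 W.tamagawaProduct : ℕ) : ℤ) +
        ((2 * padicValInt 3 D.maninConstant : ℕ) : ℤ) =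
      ((2 * padicValNat 3 (AddSubgroup.zmultiples P).index : ℕ) : ℤ)) :
    MissingPPartAt W 3 := by
  -- the twist: lower half from the shared shell + KMC, upper half from Kato
  have himgd : Kato2004.ImageContainsSL2 Wd 3 :=
    (Kato2004.imageContainsSL2_iff_forall_hasSurjectiveModNGaloisRep Wd 3).mpr htowerd
  have hLd : Wd.entireLFunction 1 ≠ 0 := (Wd.analyticRank_eq_zero_iff_holds (hmod Wd)).mp hrD
  have hfind : Finite Wd.sha := (hGZK Wd (hrD.le.trans zero_le_one)).2
  have hlowd : MissingLowerBoundAt Wd 3 := hshared Wd hOd himgd hKMC hLd hfind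
  have hMd : MissingPPartAt Wd 3 := by
    rcases hOd with h5 | h6
    · exact (ClassO5.missingPPartAt_iff_lower_of_kato Wd 3 hKato hGZK hmod hrD h5 hXd htowerd htamd
        Dd hcd).mpr hlowd
    · exact (ClassO6.missingPPartAt_iff_lower_of_kato Wd 3 hKato hGZK hmod hrD h6 hXd htowerd htamd
        Dd hcd).mpr hlowd
  -- the pair identity at 3 (Gross Conj. 1.2 granted) and its transport to W
  have hid := O5.padicValNat_shaOrder_add_twist_eq_of_heegnerIndexBSDAt hGZK W hr 3 (by decide) hHI
    hρ D K hK hH hdK H ι hP hnt Wd hWd (hrD.le.trans zero_le_one)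
  have hid' : padicValNat 3 Wd.shaOrder + padicValNat 3 W.shaOrder +
      2 * padicValNat 3 W.tamagawaProduct + 2 * padicValInt 3 D.maninConstant =
      2 * padicValNat 3 (AddSubgroup.zmultiples P).index := by omega
  have hstep0' : padicValRat 3 q₁ + padicValRat 3 q₀ + ((2 * padicValNat 3 W.tamagawaProduct : ℕ) : ℤ) +
      ((2 * padicValInt 3 D.maninConstant : ℕ) : ℤ) =
      ((2 * padicValNat 3 (AddSubgroup.zmultiples P).index : ℕ) : ℤ) := by linarith
  exact O5.missingPPartAt_twist_of_pairIdentity Wd W 3 hid' hq₁ hq₀ hstep0' hMd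

end RankOne

end Summit.BirchSwinnertonDyer.Rank1Residual.O6

end
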